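/-
Copyright: the b2b-balaban T⁴-continuum CRUX team, row NE7b OWNER lineage `t4-ne7b-p1` (gen 128). Project licence.
-/
import Summits.QuantumFields.BalabanUV.T4Continuum.Spine.NE7b.SupGaussianRegulator

/-!
# THE RENORMALISED REGULATOR IS CONTROLLED BY THE MARGIN: `M′ = M(1 − ΓM)⁻¹ ⪯ (1−θ)⁻¹·M` for `0 ⪯ M ⪯ κ·1`, `0 ⪯ Γ ⪯ γ_op·1`,
# `κγ_op ≤ θ < 1` — so the Gaussian convolution of a functional with regulated sup-norm `‖K(x)‖ ≤ A·e^{½xᵀMx}` is regulated in the external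
# field with the SAME regulator up to the factor `(1−θ)⁻¹`: `‖∫K(x+φ) dN(0,Γ)(x)‖ ≤ A·(1−θ)^{−tr(MΓ)∕(2θ)}·e^{½(1−θ)⁻¹φᵀMφ}` (the tree's exact
# regulator formula read with a margin; for `M = κ·1_Y`: `≤ A·((1−θ)^{−κγ∕(2θ)})^{#Y}·e^{½κ(1−θ)⁻¹Σ_{y∈Y}φ_y²}`) — the sharp form of (292)
# (row NE7b, node U5c; the tree's `GaussianQuadraticTilt.norm_integral_shift_le_of_norm_le_exp` + (288) BY NAME + matrix algebra; [folklore])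

Cell `pub-balaban`, sub-cell `t4`, spine estimate NE7b (`T4WeightBudget.RelWeightBound`; the cell's OWN estimate — NOT PRINTED in
[Bałaban 1983–89], NOT PROVED).  Crux-route work under `Spine/NE7b/` by the row OWNER (`t4-ne7b-p1` gen 128, file (295)) under FREEZE
(0)'s crux-prover clause, on § [NE7bP1-G127-HANDOFF] NEXT (3)(b)∕(e); NOTHING of Bałaban's is named as a Lean object, valued or asserted; no
`T4Continuum/Support` leaf typed; no `def`, no notation; zero `sorry`.  Imports (BY NAME): the OWNER's (288) `…SupGaussianRegulator`
(`sqrt_conj_posSemidef`, `smul_one_sub_sqrt_conj_posSemidef`, `trace_sqrt_conj`, `one_sub_posDef_of_margin`, `transpose_eq_of_posSemidef`,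
`sum_indicator_weight`, `diagonal_bounds`, `diagonal_form_eq`, `trace_diagonal_mul`); the tree's `GaussianQuadraticTilt`
(`norm_integral_shift_le_of_norm_le_exp`), `DetOneSubTraceBound` (`rpow_trace_le_det_one_sub`), `RegulatorSubcriticality`
(`det_one_sub_mul_eq_det_one_sub_sqrt_mul_sqrt`, `conjTranspose_cfcSqrt`), `GaussianToolkit.transpose_sqrt`; Mathlib's `Commute.mul_nonneg`
(C⋆-order on real matrices, scoped `MatrixOrder`), `Matrix.det_one_sub_mul_comm`, `CFC.sqrt_mul_sqrt_self`.

WHY (located).  (292) typed the elementary (Young) form of «activities are regulated functionals of the external field»; the EXACT statement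
is the tree's renormalised regulator `M′ = M(1−ΓM)⁻¹` (`GaussianQuadraticTilt`, `RegulatorRenormalisation`: the semigroup `M ↦ M′` along a
covariance decomposition).  For the road's multiscale use one needs `M′` CONTROLLED by `M`: with the margin `√MΓ√M ⪯ θ·1` of (288) this is
the Loewner bound `M′ ⪯ (1−θ)⁻¹M` (push-through `M′ = √M(1−√MΓ√M)⁻¹√M` and `(1−B)(θ·1−B) ⪰ 0` for the commuting pair), typed here, so that
the regulator of the activities after integrating a scale is the SAME cell regulator with strength `κ∕(1−θ)`.

WHAT IS PROVED ([folklore]; `B = √M Γ √M`):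
* §1 `margin_swap` (`0 ⪯ M ⪯ κ·1`, `Γ ⪯ γ_op·1`, `0 ≤ γ_op`, `κγ_op ≤ θ` ⟹ `B ⪯ θ·1`), `sqrt_mul_one_sub` (`(1−B)√M = √M(1−ΓM)`),
  `det_one_sub_mul_eq_det_one_sub_conj` (`det(1−ΓM) = det(1−B)`), **`renorm_eq_sqrt_conj_inv`** (`M(1−ΓM)⁻¹ = √M(1−B)⁻¹√M`);
* §2 `posSemidef_mul_of_commute`, `one_sub_mul_margin_posSemidef` (`(1−B)(θ·1−B) ⪰ 0`), **`renorm_form_le`**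
  (`φᵀM(1−ΓM)⁻¹φ ≤ (1−θ)⁻¹·φᵀMφ` for every `φ`);
* §3 `inv_sqrt_det_le` (`1∕√det(1−ΓM) ≤ (1−θ)^{−tr(MΓ)∕(2θ)}`), THE END **`regulated_convolution_le`**
  (`‖K x‖ ≤ A·e^{½xᵀMx}` ⟹ `‖∫K(x+φ)dN(0,Γ)‖ ≤ A·(1−θ)^{−tr(MΓ)∕(2θ)}·e^{½(1−θ)⁻¹φᵀMφ}`), and the cell form
  **`regulated_convolution_on_le`** (`M = κ·1_Y`, `Γ(y,y) ≤ γ` on `Y`: `≤ A·((1−θ)^{−κγ∕(2θ)})^{#Y}·e^{½κ(1−θ)⁻¹Σ_{y∈Y}φ_y²}`); §4 toy.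

HONEST (what this is NOT).  Matrix algebra and the tree's Gaussian formula; no cells∕polymers (those are (289)∕(292)); one convolution (the
flow along (280)'s scales is the tree's `regFlow`, whose margin propagation `RegulatorSubcriticality.regFlow_margin` is not re-read here);
scalar skeleton ((A3), NC-NE7b-α UNRULED); nothing of Bałaban's asserted.  BY-NAME EFFECT ON THE WALL: NONE.  NE7b NOT PRINTED ∕ NOT PROVED;
spine PROVED 0∕9; rung (B)+1 — the programme's measures remain FINITE-torus statements; NOT the mass gap, NOT Clay.  HONEST DEPENDENCY: continuum
YM on T⁴ ⇐ BetaPertH ∧ nine spine estimates (0∕9 proved); BetaPertH ⇐ (D1) ∧ (D4) ∧ CAP+tail; G-an2-4 gates asym, D1 and NE2∕3∕4.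
-/

set_option autoImplicit false

noncomputable section

namespace Summit.QuantumFields.BalabanUV.T4Continuum.NE7b.SupRegulatorRenormalised

open MeasureTheory ProbabilityTheory Matrix Real WithLp
open scoped MatrixOrder ComplexOrder BigOperators
open Literature.Probability.Distributions (norm_integral_shift_le_of_norm_le_exp)
open Literature.Analysis.Matrix (rpow_trace_le_det_one_sub det_one_sub_mul_eq_det_one_sub_sqrt_mul_sqrt)
open Literature.MathematicalPhysics.QuantumFieldTheory.GaussianToolkit (transpose_sqrt)
open SupGaussianRegulator (sqrt_conj_posSemidef smul_one_sub_sqrt_conj_posSemidef trace_sqrt_conj one_sub_posDef_of_margin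
  transpose_eq_of_posSemidef sum_indicator_weight diagonal_bounds diagonal_form_eq trace_diagonal_mul)

variable {ι : Type*} [Fintype ι] [DecidableEq ι]

/-! ## §1. Push-through: `M(1−ΓM)⁻¹ = √M(1−√MΓ√M)⁻¹√M` -/

/-- **THE MARGIN, REGULATOR SIDE**: `0 ⪯ M ⪯ κ·1`, `Γ ⪯ γ_op·1`, `0 ≤ γ_op`, `κγ_op ≤ θ` ⟹ `√M Γ √M ⪯ θ·1`. [folklore] -/
theorem margin_swap {Γ M : Matrix ι ι ℝ} {γop κ θ : ℝ} (hM : M.PosSemidef) (hMκ : (κ • (1 : Matrix ι ι ℝ) - M).PosSemidef)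
    (hΓop : (γop • (1 : Matrix ι ι ℝ) - Γ).PosSemidef) (hγop : 0 ≤ γop) (hκθ : κ * γop ≤ θ) :
    (θ • (1 : Matrix ι ι ℝ) - CFC.sqrt M * Γ * CFC.sqrt M).PosSemidef := by
  have h := smul_one_sub_sqrt_conj_posSemidef hM hMκ hΓop hγop
  have h' : ((θ - γop * κ) • (1 : Matrix ι ι ℝ)).PosSemidef := Matrix.PosSemidef.one.smul (by nlinarith)
  have h'' := h.add h'
  rw [sub_smul] at h''
  convert h'' using 1
  abel

/-- `(1 − √MΓ√M)√M = √M(1 − ΓM)` for `M ⪰ 0`. [folklore] -/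
theorem sqrt_mul_one_sub {M : Matrix ι ι ℝ} (hM : M.PosSemidef) (Γ : Matrix ι ι ℝ) :
    (1 - CFC.sqrt M * Γ * CFC.sqrt M) * CFC.sqrt M = CFC.sqrt M * (1 - Γ * M) := by
  rw [Matrix.sub_mul, Matrix.one_mul, Matrix.mul_sub, Matrix.mul_one, Matrix.mul_assoc, Matrix.mul_assoc,
    CFC.sqrt_mul_sqrt_self M hM.nonneg]

/-- `det(1 − ΓM) = det(1 − √MΓ√M)` for `M ⪰ 0`. [folklore] -/
theorem det_one_sub_mul_eq_det_one_sub_conj {M : Matrix ι ι ℝ} (hM : M.PosSemidef) (Γ : Matrix ι ι ℝ) :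
    (1 - Γ * M).det = (1 - CFC.sqrt M * Γ * CFC.sqrt M).det := by
  conv_lhs => rw [← CFC.sqrt_mul_sqrt_self M hM.nonneg, ← Matrix.mul_assoc, Matrix.det_one_sub_mul_comm, ← Matrix.mul_assoc]

/-- **PUSH-THROUGH**: `M(1 − ΓM)⁻¹ = √M(1 − √MΓ√M)⁻¹√M` when `1 − √MΓ√M` is invertible (`M ⪰ 0`). [folklore] -/
theorem renorm_eq_sqrt_conj_inv {Γ M : Matrix ι ι ℝ} (hM : M.PosSemidef) (hU : IsUnit (1 - CFC.sqrt M * Γ * CFC.sqrt M).det) :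
    M * (1 - Γ * M)⁻¹ = CFC.sqrt M * (1 - CFC.sqrt M * Γ * CFC.sqrt M)⁻¹ * CFC.sqrt M := by
  have hU' : IsUnit (1 - Γ * M).det := by rwa [det_one_sub_mul_eq_det_one_sub_conj hM]
  have key : CFC.sqrt M * (1 - Γ * M)⁻¹ = (1 - CFC.sqrt M * Γ * CFC.sqrt M)⁻¹ * CFC.sqrt M := by
    calc CFC.sqrt M * (1 - Γ * M)⁻¹
        = (1 - CFC.sqrt M * Γ * CFC.sqrt M)⁻¹ * ((1 - CFC.sqrt M * Γ * CFC.sqrt M) * CFC.sqrt M) * (1 - Γ * M)⁻¹ := by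
          rw [Matrix.nonsing_inv_mul_cancel_left _ _ hU]
      _ = (1 - CFC.sqrt M * Γ * CFC.sqrt M)⁻¹ * (CFC.sqrt M * (1 - Γ * M) * (1 - Γ * M)⁻¹) := by
          rw [sqrt_mul_one_sub hM, Matrix.mul_assoc]
      _ = (1 - CFC.sqrt M * Γ * CFC.sqrt M)⁻¹ * CFC.sqrt M := by rw [Matrix.mul_nonsing_inv_cancel_right _ _ hU']
  calc M * (1 - Γ * M)⁻¹ = CFC.sqrt M * (CFC.sqrt M * (1 - Γ * M)⁻¹) := by
        rw [← Matrix.mul_assoc, CFC.sqrt_mul_sqrt_self M hM.nonneg]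
    _ = CFC.sqrt M * (1 - CFC.sqrt M * Γ * CFC.sqrt M)⁻¹ * CFC.sqrt M := by rw [key, ← Matrix.mul_assoc]

/-! ## §2. The Loewner bound `M′ ⪯ (1−θ)⁻¹M` -/

/-- Commuting positive semidefinite real matrices have a positive semidefinite product (C⋆-order). [folklore] -/
theorem posSemidef_mul_of_commute {X Y : Matrix ι ι ℝ} (hX : X.PosSemidef) (hY : Y.PosSemidef) (h : Commute X Y) :
    (X * Y).PosSemidef :=
  (Commute.mul_nonneg hX.nonneg hY.nonneg h).posSemidef

/-- `(1 − B)(θ·1 − B) ⪰ 0` when `B ⪯ θ·1` and `θ < 1` (a commuting pair of positive semidefinite matrices). [folklore] -/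
theorem one_sub_mul_margin_posSemidef {B : Matrix ι ι ℝ} {θ : ℝ} (hθ1 : θ < 1) (hBθ : (θ • (1 : Matrix ι ι ℝ) - B).PosSemidef) :
    ((1 - B) * (θ • (1 : Matrix ι ι ℝ) - B)).PosSemidef := by
  refine posSemidef_mul_of_commute (one_sub_posDef_of_margin hθ1 hBθ).posSemidef hBθ ?_
  -- both are polynomials in `B`
  exact (Commute.one_left _).sub_left (((Commute.one_right B).smul_right θ).sub_right (Commute.refl B))

/-- **THE RENORMALISED REGULATOR IS AT MOST `(1−θ)⁻¹M` AS A FORM**: `0 ⪯ M ⪯ κ·1`, `0 ⪯ Γ ⪯ γ_op·1`, `0 ≤ γ_op`, `κγ_op ≤ θ < 1` ⟹ for every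
`φ`: `φᵀ·M(1−ΓM)⁻¹·φ ≤ (1−θ)⁻¹·φᵀMφ`. [folklore] -/
theorem renorm_form_le {Γ M : Matrix ι ι ℝ} {γop κ θ : ℝ} (hM : M.PosSemidef) (hMκ : (κ • (1 : Matrix ι ι ℝ) - M).PosSemidef)
    (hΓop : (γop • (1 : Matrix ι ι ℝ) - Γ).PosSemidef) (hγop : 0 ≤ γop) (hθ1 : θ < 1) (hκθ : κ * γop ≤ θ) (φ : ι → ℝ) :
    φ ⬝ᵥ (M * (1 - Γ * M)⁻¹) *ᵥ φ ≤ (1 - θ)⁻¹ * (φ ⬝ᵥ M *ᵥ φ) := by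
  set T := CFC.sqrt M with hTdef
  set B := T * Γ * T with hB
  have hBθ : (θ • (1 : Matrix ι ι ℝ) - B).PosSemidef := margin_swap hM hMκ hΓop hγop hκθ
  have h1B : (1 - B).PosDef := one_sub_posDef_of_margin hθ1 hBθ
  have hU : IsUnit (1 - B).det := h1B.isUnit.map Matrix.detMonoidHom
  have hT : Tᵀ = T := transpose_sqrt (S := M)
  have hTT : T * T = M := CFC.sqrt_mul_sqrt_self M hM.nonneg
  have h1BT : (1 - B)ᵀ = 1 - B := transpose_eq_of_posSemidef h1B.posSemidef
  have h1θ : 0 < 1 - θ := by linarith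
  rw [renorm_eq_sqrt_conj_inv hM hU, ← hB]
  -- symmetry of `T` and `1 − B` as bilinear identities
  have hsym : ∀ v : ι → ℝ, φ ⬝ᵥ T *ᵥ v = (T *ᵥ φ) ⬝ᵥ v := fun v => by
    rw [dotProduct_mulVec, ← vecMul_transpose, hT]
  have h1Bsym : ∀ u v : ι → ℝ, u ⬝ᵥ (1 - B) *ᵥ v = ((1 - B) *ᵥ u) ⬝ᵥ v := fun u v => by
    rw [dotProduct_mulVec, ← vecMul_transpose, h1BT]
  -- coordinates: `Tφ = (1 − B)z`
  obtain ⟨z, hz⟩ : ∃ z : ι → ℝ, z = (1 - B)⁻¹ *ᵥ (T *ᵥ φ) := ⟨_, rfl⟩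
  have hyz : (1 - B) *ᵥ z = T *ᵥ φ := by rw [hz, mulVec_mulVec, mul_nonsing_inv _ hU, one_mulVec]
  -- left side: `φᵀ T (1−B)⁻¹ T φ = (Tφ)ᵀ(1−B)⁻¹(Tφ) = ((1−B)z)ᵀ z = zᵀ(1−B)z`
  have hlhs : φ ⬝ᵥ (T * (1 - B)⁻¹ * T) *ᵥ φ = z ⬝ᵥ (1 - B) *ᵥ z := by
    rw [← mulVec_mulVec, ← mulVec_mulVec, hsym, ← hyz, mulVec_mulVec, nonsing_inv_mul _ hU, one_mulVec]
    exact (h1Bsym z z).symm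
  -- right side: `φᵀMφ = (Tφ)ᵀ(Tφ) = zᵀ(1−B)²z`
  have hrhs : φ ⬝ᵥ M *ᵥ φ = z ⬝ᵥ ((1 - B) * (1 - B)) *ᵥ z := by
    rw [← hTT, ← mulVec_mulVec, hsym, ← hyz, ← h1Bsym, mulVec_mulVec]
  rw [hlhs, hrhs]
  -- `(1−θ)·zᵀ(1−B)z ≤ zᵀ(1−B)²z` from `(1−B)(θ·1−B) ⪰ 0`
  have hprod := (one_sub_mul_margin_posSemidef hθ1 hBθ).dotProduct_mulVec_nonneg z
  rw [star_trivial] at hprod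
  have hexp : z ⬝ᵥ ((1 - B) * (θ • (1 : Matrix ι ι ℝ) - B)) *ᵥ z = z ⬝ᵥ ((1 - B) * (1 - B)) *ᵥ z - (1 - θ) * (z ⬝ᵥ (1 - B) *ᵥ z) := by
    have hsplit : (1 - B) * (θ • (1 : Matrix ι ι ℝ) - B) = (1 - B) * (1 - B) - (1 - θ) • (1 - B) := by
      rw [Matrix.mul_sub, Matrix.mul_sub, Matrix.mul_smul, Matrix.mul_one, sub_smul, one_smul]
      abel
    rw [hsplit, sub_mulVec, dotProduct_sub, smul_mulVec, dotProduct_smul, smul_eq_mul]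
  rw [hexp] at hprod
  rw [← div_eq_inv_mul, le_div_iff₀ h1θ]
  linarith

/-! ## §3. THE END: regulated sup-norms under Gaussian convolution, with the margin -/

/-- `1∕√det(1 − ΓM) ≤ (1−θ)^{−tr(MΓ)∕(2θ)}` for `0 ⪯ Γ ⪯ γ_op·1`, `0 ⪯ M ⪯ κ·1`, `0 ≤ κ`, `0 < θ < 1`, `κγ_op ≤ θ` ((288)'s step, stated).
[folklore] -/
theorem inv_sqrt_det_le {Γ M : Matrix ι ι ℝ} {γop κ θ : ℝ} (hΓ : Γ.PosSemidef) (hΓop : (γop • (1 : Matrix ι ι ℝ) - Γ).PosSemidef)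
    (hM : M.PosSemidef) (hMκ : (κ • (1 : Matrix ι ι ℝ) - M).PosSemidef) (hκ : 0 ≤ κ) (hθ0 : 0 < θ) (hθ1 : θ < 1) (hκθ : κ * γop ≤ θ) :
    1 / Real.sqrt (1 - Γ * M).det ≤ (1 - θ) ^ (-((M * Γ).trace / (2 * θ))) := by
  set B := CFC.sqrt Γ * M * CFC.sqrt Γ with hB
  have hB0 : B.PosSemidef := sqrt_conj_posSemidef Γ hM
  have hBθ : (θ • (1 : Matrix ι ι ℝ) - B).PosSemidef := by
    have h := smul_one_sub_sqrt_conj_posSemidef hΓ hΓop hMκ hκ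
    have h' : ((θ - κ * γop) • (1 : Matrix ι ι ℝ)).PosSemidef := Matrix.PosSemidef.one.smul (by linarith)
    have h'' := h.add h'
    rw [sub_smul] at h''
    convert h'' using 1
    abel
  have h1θ : 0 < 1 - θ := by linarith
  rw [det_one_sub_mul_eq_det_one_sub_sqrt_mul_sqrt hΓ M, ← hB, ← trace_sqrt_conj hΓ M, ← hB]
  have hlow : (1 - θ) ^ (B.trace / θ) ≤ (1 - B).det := rpow_trace_le_det_one_sub hB0 hθ0 hθ1 hBθ
  have hpos : 0 < (1 - θ) ^ (B.trace / θ) := Real.rpow_pos_of_pos h1θ _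
  calc 1 / Real.sqrt (1 - B).det ≤ 1 / Real.sqrt ((1 - θ) ^ (B.trace / θ)) :=
        one_div_le_one_div_of_le (Real.sqrt_pos.2 hpos) (Real.sqrt_le_sqrt hlow)
    _ = (1 - θ) ^ (-(B.trace / (2 * θ))) := by
        rw [Real.sqrt_eq_rpow, ← Real.rpow_mul h1θ.le, Real.rpow_neg h1θ.le, one_div]
        congr 2
        ring

/-- **THE END — REGULATED SUP-NORMS UNDER GAUSSIAN CONVOLUTION, WITH THE MARGIN.**  `0 ⪯ Γ ⪯ γ_op·1` (`γ_op ≥ 0`), `0 ⪯ M ⪯ κ·1` (`κ ≥ 0`),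
`0 < θ < 1`, `κγ_op ≤ θ`; a functional `K` on `ℝ^ι` with `‖K x‖ ≤ A·e^{½xᵀMx}` for all `x` ⟹ for every external field `φ`:
`‖∫ K(x + φ) dN(0,Γ)(x)‖ ≤ A · (1−θ)^{−tr(MΓ)∕(2θ)} · e^{½(1−θ)⁻¹φᵀMφ}`. [folklore] -/
theorem regulated_convolution_le {E : Type*} [NormedAddCommGroup E] [NormedSpace ℝ E] {Γ M : Matrix ι ι ℝ} {γop κ θ A : ℝ}
    (hΓ : Γ.PosSemidef) (hΓop : (γop • (1 : Matrix ι ι ℝ) - Γ).PosSemidef) (hγop : 0 ≤ γop) (hM : M.PosSemidef)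
    (hMκ : (κ • (1 : Matrix ι ι ℝ) - M).PosSemidef) (hκ : 0 ≤ κ) (hθ0 : 0 < θ) (hθ1 : θ < 1) (hκθ : κ * γop ≤ θ) (hA : 0 ≤ A)
    {K : (ι → ℝ) → E} (hK : ∀ x, ‖K x‖ ≤ A * exp ((x ⬝ᵥ M *ᵥ x) / 2)) (φ : ι → ℝ) :
    ‖∫ x, K (ofLp x + φ) ∂(multivariateGaussian 0 Γ)‖ ≤
      A * (1 - θ) ^ (-((M * Γ).trace / (2 * θ))) * exp ((1 - θ)⁻¹ * (φ ⬝ᵥ M *ᵥ φ) / 2) := by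
  -- subcriticality from the margin on the covariance side
  have hBθ : (θ • (1 : Matrix ι ι ℝ) - CFC.sqrt Γ * M * CFC.sqrt Γ).PosSemidef := by
    have h := smul_one_sub_sqrt_conj_posSemidef hΓ hΓop hMκ hκ
    have h' : ((θ - κ * γop) • (1 : Matrix ι ι ℝ)).PosSemidef := Matrix.PosSemidef.one.smul (by linarith)
    have h'' := h.add h'
    rw [sub_smul] at h''
    convert h'' using 1
    abel
  have hsub : (1 - CFC.sqrt Γ * M * CFC.sqrt Γ).PosDef := one_sub_posDef_of_margin hθ1 hBθ
  have h := norm_integral_shift_le_of_norm_le_exp hΓ (transpose_eq_of_posSemidef hM) hsub hK φ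
  refine h.trans ?_
  have hdet := inv_sqrt_det_le hΓ hΓop hM hMκ hκ hθ0 hθ1 hκθ
  have hform := renorm_form_le hM hMκ hΓop hγop hθ1 hκθ φ
  have hexp : exp ((φ ⬝ᵥ (M * (1 - Γ * M)⁻¹) *ᵥ φ) / 2) ≤ exp ((1 - θ)⁻¹ * (φ ⬝ᵥ M *ᵥ φ) / 2) :=
    exp_le_exp.2 (by linarith)
  calc A * (exp ((φ ⬝ᵥ (M * (1 - Γ * M)⁻¹) *ᵥ φ) / 2) / Real.sqrt (1 - Γ * M).det)
      = A * (1 / Real.sqrt (1 - Γ * M).det) * exp ((φ ⬝ᵥ (M * (1 - Γ * M)⁻¹) *ᵥ φ) / 2) := by ring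
    _ ≤ A * (1 - θ) ^ (-((M * Γ).trace / (2 * θ))) * exp ((1 - θ)⁻¹ * (φ ⬝ᵥ M *ᵥ φ) / 2) :=
        mul_le_mul (mul_le_mul_of_nonneg_left hdet hA) hexp (exp_pos _).le
          (mul_nonneg hA (Real.rpow_nonneg (by linarith) _))

/-- **THE CELL FORM**: for the indicator regulator `M = κ·1_Y` (`0 ≤ κ`) and `Γ(y,y) ≤ γ` on `Y`:
`‖∫K(x+φ)dN(0,Γ)‖ ≤ A·((1−θ)^{−κγ∕(2θ)})^{#Y}·e^{½κ(1−θ)⁻¹Σ_{y∈Y}φ_y²}` whenever `‖K x‖ ≤ A·e^{½κΣ_{y∈Y}x_y²}` — the external-field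
regulator lives on the SAME sites with strength `κ∕(1−θ)`. [folklore] -/
theorem regulated_convolution_on_le {E : Type*} [NormedAddCommGroup E] [NormedSpace ℝ E] {Γ : Matrix ι ι ℝ} {γop γ κ θ A : ℝ}
    (hΓ : Γ.PosSemidef) (hΓop : (γop • (1 : Matrix ι ι ℝ) - Γ).PosSemidef) (hγop : 0 ≤ γop) (hκ : 0 ≤ κ) (hθ0 : 0 < θ) (hθ1 : θ < 1)
    (hκθ : κ * γop ≤ θ) (hA : 0 ≤ A) (Y : Finset ι) (hdiag : ∀ i ∈ Y, Γ i i ≤ γ) {K : (ι → ℝ) → E}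
    (hK : ∀ x, ‖K x‖ ≤ A * exp (κ * (∑ i ∈ Y, x i ^ 2) / 2)) (φ : ι → ℝ) :
    ‖∫ x, K (ofLp x + φ) ∂(multivariateGaussian 0 Γ)‖ ≤
      A * ((1 - θ) ^ (-(κ * γ / (2 * θ)))) ^ Y.card * exp (κ * (1 - θ)⁻¹ * (∑ i ∈ Y, φ i ^ 2) / 2) := by
  set w : ι → ℝ := fun i => if i ∈ Y then κ else 0 with hw
  have hw0 : ∀ i, 0 ≤ w i := fun i => by simp only [hw]; split_ifs <;> [exact hκ; exact le_rfl]
  have hwκ : ∀ i, w i ≤ κ := fun i => by simp only [hw]; split_ifs <;> [exact le_rfl; exact hκ]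
  obtain ⟨hM, hMκ⟩ := diagonal_bounds w hw0 hwκ
  have hK' : ∀ x, ‖K x‖ ≤ A * exp ((x ⬝ᵥ (diagonal w) *ᵥ x) / 2) := fun x => by
    rw [diagonal_form_eq, sum_indicator_weight Y κ (fun i => x i ^ 2)]
    exact hK x
  have h := regulated_convolution_le hΓ hΓop hγop hM hMκ hκ hθ0 hθ1 hκθ hA hK' φ
  rw [trace_diagonal_mul, sum_indicator_weight Y κ (fun i => Γ i i), diagonal_form_eq, sum_indicator_weight Y κ (fun i => φ i ^ 2)] at h
  refine h.trans ?_
  have h1θ : 0 < 1 - θ := by linarith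
  have h1θ' : 1 - θ ≤ 1 := by linarith
  have hsum : κ * ∑ i ∈ Y, Γ i i ≤ κ * (γ * Y.card) := by
    refine mul_le_mul_of_nonneg_left ?_ hκ
    calc ∑ i ∈ Y, Γ i i ≤ ∑ _i ∈ Y, γ := Finset.sum_le_sum hdiag
      _ = γ * Y.card := by rw [Finset.sum_const, nsmul_eq_mul, mul_comm]
  have hpow : (1 - θ) ^ (-((κ * ∑ i ∈ Y, Γ i i) / (2 * θ))) ≤ ((1 - θ) ^ (-(κ * γ / (2 * θ)))) ^ Y.card := by
    calc (1 - θ) ^ (-((κ * ∑ i ∈ Y, Γ i i) / (2 * θ)))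
        ≤ (1 - θ) ^ (-(κ * (γ * Y.card) / (2 * θ))) := by
          refine Real.rpow_le_rpow_of_exponent_ge h1θ h1θ' ?_
          have : (κ * ∑ i ∈ Y, Γ i i) / (2 * θ) ≤ κ * (γ * Y.card) / (2 * θ) := div_le_div_of_nonneg_right hsum (by linarith)
          linarith
      _ = ((1 - θ) ^ (-(κ * γ / (2 * θ)))) ^ Y.card := by
          rw [← Real.rpow_natCast, ← Real.rpow_mul h1θ.le]
          congr 1
          ring
  have heq : exp ((1 - θ)⁻¹ * (κ * ∑ i ∈ Y, φ i ^ 2) / 2) = exp (κ * (1 - θ)⁻¹ * (∑ i ∈ Y, φ i ^ 2) / 2) := by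
    congr 1
    ring
  rw [heq]
  exact mul_le_mul_of_nonneg_right (mul_le_mul_of_nonneg_left hpow hA) (exp_pos _).le

/-! ## §4. Toy -/

/-- Toy (§1 with `M = 0`): the renormalised regulator of the zero regulator is zero. -/
example (Γ : Matrix (Fin 2) (Fin 2) ℝ) : (0 : Matrix (Fin 2) (Fin 2) ℝ) * (1 - Γ * 0)⁻¹ = 0 := by
  rw [Matrix.zero_mul]

end Summit.QuantumFields.BalabanUV.T4Continuum.NE7b.SupRegulatorRenormalised
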